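import Literature.NumberTheory.Sieve.SmoothParityHcSumLemmas
import Literature.NumberTheory.Sieve.SmoothEndgameEuler
import HarnessLib

/-!
# A uniform bound for the majorant sum `𝓗₃(R)` of the parity-class major arcs

Topic `Literature/NumberTheory/Sieve`, namespace `Literature.NumberTheory.Sieve.SmoothArcs`; a PROVED tool file of the
circle-method engine of `SmoothParityTernary` ([Harper2016, §2.2, §5], [MontgomeryVaughanActa1975, §5–6]).  The major-arc
theorem `parity_major_arcs` (`SmoothParityMajorArcs`) multiplies its decaying precision `η` by the arithmetic sum
`𝓗₃(R) = Σ_{1 ≤ k ≤ R} Σ_{a < k, (k,a)=1} Hc(2,1,k; d₁a) Hc(2,1,k; σd₂a) Hc(1,0,k; a)` of the cancelling majorants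
`Hc = classLocalHc α` (`SmoothArcClassesMajorant`), which must therefore be bounded UNIFORMLY in `R`.  With the
modulus-one majorant `𝓗(k;h) = unitLocalHc α k h` and its multiplicative majorant `unitHcMajorant`
(`SmoothParityHcSumLemmas`: `Hc(2,1,k;h) ≤ 2𝓗(k;h)`, `𝓗(k;hu) = 𝓗(k;h)` for units `u`,
`𝓗(k;h) ≤ (h,k)τ((h,k)) k^{−α} 5^{ω(k)}`):

* `sum_coprime_classLocalHc_triple_le`: the `a`-sum at level `k` is
  `≤ 4 d₁τ(d₁) d₂τ(d₂) · k^{−(3α−1)} ∏_{p ∣ k} 125` (`φ(k) ≤ k` classes, each factor by its majorant);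
* `parityHcSum3_le_explicit`: for `2/3 < α ≤ 1`, `σ = ±1`, `d₁, d₂ ≥ 1` and every `R`,
  `𝓗₃(R) ≤ 4 exp(250/(3α−2)) · d₁τ(d₁) · d₂τ(d₂)` (finite Euler product `Endgame.sum_rpow_neg_mul_prod_primeFactors_le`
  and `Σ_p p^{−(3α−1)} ≤ 1/(3α−2)`);
* `parityHcSum3_le`: the packaged form `∃ C > 0` uniform in `α ∈ [1 − 10⁻⁴, 1]`, `σ`, `R` (with `C = 4e^{251}`).

No parity hypothesis on `d₁, d₂` is needed: the reduction `Hc(2,1,k;h) ≤ 2𝓗(k;h)` already gives the decay `k^{1−3α}`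
of the `k`-th term up to divisor-type factors.

## References

* A. J. Harper, Compositio Math. 152 (2016), §2.2, §5 [Harper2016].
* H. L. Montgomery, R. C. Vaughan, Acta Arith. 27 (1975), §5–6 [MontgomeryVaughanActa1975].
* H. L. Montgomery, R. C. Vaughan, *Multiplicative Number Theory I* (2007), §1.3, Thm 4.1 [MontgomeryVaughan2007].
-/

noncomputable section

open Finset Real Complex

namespace Literature.NumberTheory.Sieve

namespace SmoothArcs

/-! ### The level-`k` term -/

/-- `(d, k) τ((d, k)) ≤ d τ(d)` for `d ≥ 1`. [folklore] -/
theorem gcd_mul_card_divisors_le {d : ℕ} (hd : d ≠ 0) (k : ℕ) :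
    ((Nat.gcd d k : ℕ) : ℝ) * ((Nat.gcd d k).divisors.card : ℝ) ≤ (d : ℝ) * (d.divisors.card : ℝ) := by
  have h1 : Nat.gcd d k ≤ d := Nat.gcd_le_left k (Nat.pos_of_ne_zero hd)
  have h2 : (Nat.gcd d k).divisors.card ≤ d.divisors.card :=
    Finset.card_le_card (Nat.divisors_subset_of_dvd hd (Nat.gcd_dvd_left d k))
  exact mul_le_mul (by exact_mod_cast h1) (by exact_mod_cast h2) (Nat.cast_nonneg _) (Nat.cast_nonneg _)

/-- `unitHcMajorant α d k ≤ d τ(d) · k^{−α} ∏_{p ∣ k} 5` for `d ≥ 1`. [folklore] -/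
theorem unitHcMajorant_le (α : ℝ) {d : ℕ} (hd : d ≠ 0) (k : ℕ) :
    unitHcMajorant α d k ≤ (d : ℝ) * (d.divisors.card : ℝ) * ((k : ℝ) ^ (-α) * ∏ _p ∈ k.primeFactors, (5 : ℝ)) :=
  mul_le_mul_of_nonneg_right (gcd_mul_card_divisors_le hd k)
    (mul_nonneg (Real.rpow_nonneg (Nat.cast_nonneg _) _) (Finset.prod_nonneg fun _ _ => by norm_num))

/-- `unitHcMajorant α 1 k = k^{−α} ∏_{p ∣ k} 5`. [folklore] -/
theorem unitHcMajorant_one (α : ℝ) (k : ℕ) :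
    unitHcMajorant α 1 k = (k : ℝ) ^ (-α) * ∏ _p ∈ k.primeFactors, (5 : ℝ) := by
  simp [unitHcMajorant]

/-- `k · (k^{−α} 5^{ω})³ = k^{−(3α−1)} ∏_{p ∣ k} 125` (`k ≥ 1`). [folklore] -/
theorem mul_cube_rpow_prod_eq {α : ℝ} {k : ℕ} (hk : k ≠ 0) :
    (k : ℝ) * (((k : ℝ) ^ (-α) * ∏ _p ∈ k.primeFactors, (5 : ℝ)) * ((k : ℝ) ^ (-α) * ∏ _p ∈ k.primeFactors, (5 : ℝ)) *
      ((k : ℝ) ^ (-α) * ∏ _p ∈ k.primeFactors, (5 : ℝ))) =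
      (k : ℝ) ^ (-(3 * α - 1)) * ∏ _p ∈ k.primeFactors, (125 : ℝ) := by
  have hk0 : (0 : ℝ) < k := by exact_mod_cast Nat.pos_of_ne_zero hk
  rw [Finset.prod_const, Finset.prod_const]
  have e : -(3 * α - 1) = 1 + (-α) + (-α) + (-α) := by ring
  rw [e, Real.rpow_add hk0, Real.rpow_add hk0, Real.rpow_add hk0, Real.rpow_one,
    show (125 : ℝ) = 5 * 5 * 5 by norm_num, mul_pow, mul_pow]
  ring

/-- **The level-`k` term.** For `α ≤ 1`, `σ = ±1`, `d₁, d₂, k ≥ 1`: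
`Σ_{a < k, (k,a)=1} Hc(2,1,k;d₁a) Hc(2,1,k;σd₂a) Hc(1,0,k;a) ≤ 4 d₁τ(d₁) d₂τ(d₂) · k^{−(3α−1)} ∏_{p ∣ k} 125`
(`Hc(2,1,k;d_i a u) ≤ 2𝓗(k;d_i) ≤ 2 d_iτ(d_i) k^{−α}5^{ω(k)}`, `Hc(1,0,k;a) = 𝓗(k;1) ≤ k^{−α}5^{ω(k)}`, at most `k`
classes `a`). [cite: Harper2016, §2.2, §5] -/
theorem sum_coprime_classLocalHc_triple_le {α : ℝ} (hα1 : α ≤ 1) {σ : ℤ} (hσ : σ = 1 ∨ σ = -1) {d₁ d₂ : ℕ}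
    (hd₁ : d₁ ≠ 0) (hd₂ : d₂ ≠ 0) {k : ℕ} (hk : k ≠ 0) :
    ∑ a ∈ (Finset.range k).filter (Nat.Coprime k),
        classLocalHc α 2 1 k (d₁ * a) * classLocalHc α 2 1 k (σ * (d₂ * a)) * classLocalHc α 1 0 k a ≤
      4 * ((d₁ : ℝ) * (d₁.divisors.card : ℝ)) * ((d₂ : ℝ) * (d₂.divisors.card : ℝ)) *
        ((k : ℝ) ^ (-(3 * α - 1)) * ∏ _p ∈ k.primeFactors, (125 : ℝ)) := by
  set B : ℝ := (k : ℝ) ^ (-α) * ∏ _p ∈ k.primeFactors, (5 : ℝ) with hB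
  have hB0 : 0 ≤ B := mul_nonneg (Real.rpow_nonneg (Nat.cast_nonneg _) _) (Finset.prod_nonneg fun _ _ => by norm_num)
  set D₁ : ℝ := (d₁ : ℝ) * (d₁.divisors.card : ℝ) with hD₁
  set D₂ : ℝ := (d₂ : ℝ) * (d₂.divisors.card : ℝ) with hD₂
  have hD₁0 : 0 ≤ D₁ := mul_nonneg (Nat.cast_nonneg _) (Nat.cast_nonneg _)
  have hD₂0 : 0 ≤ D₂ := mul_nonneg (Nat.cast_nonneg _) (Nat.cast_nonneg _)
  have hM1 : unitLocalHc α k d₁ ≤ D₁ * B := by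
    have h1 := unitLocalHc_le_majorant hα1 (d₁ : ℤ) hk
    rw [Int.natAbs_natCast] at h1
    exact h1.trans (unitHcMajorant_le α hd₁ k)
  have hM2 : unitLocalHc α k d₂ ≤ D₂ * B := by
    have h2 := unitLocalHc_le_majorant hα1 (d₂ : ℤ) hk
    rw [Int.natAbs_natCast] at h2
    exact h2.trans (unitHcMajorant_le α hd₂ k)
  have hM3 : unitLocalHc α k 1 ≤ B := by
    have h3 := unitLocalHc_le_majorant hα1 (1 : ℤ) hk
    rwa [Int.natAbs_one, unitHcMajorant_one] at h3
  have hσ1 : σ.natAbs = 1 := by rcases hσ with rfl | rfl <;> rfl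
  have hpt : ∀ a ∈ (Finset.range k).filter (Nat.Coprime k),
      classLocalHc α 2 1 k (d₁ * a) * classLocalHc α 2 1 k (σ * (d₂ * a)) * classLocalHc α 1 0 k a ≤
        (2 * (D₁ * B)) * (2 * (D₂ * B)) * B := by
    intro a ha
    obtain ⟨-, hka⟩ := Finset.mem_filter.mp ha
    have hu1 : k.Coprime (a : ℤ).natAbs := by simpa using hka
    have hu2 : k.Coprime ((a : ℤ) * σ).natAbs := by rw [Int.natAbs_mul, hσ1, mul_one]; simpa using hka
    have b1 : classLocalHc α 2 1 k (d₁ * a) ≤ 2 * (D₁ * B) := by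
      refine (classLocalHc_two_one_le α k _).trans ?_
      rw [unitLocalHc_mul_unit α hu1 (d₁ : ℤ)]
      linarith
    have b2 : classLocalHc α 2 1 k (σ * (d₂ * a)) ≤ 2 * (D₂ * B) := by
      refine (classLocalHc_two_one_le α k _).trans ?_
      rw [show σ * ((d₂ : ℤ) * a) = d₂ * (a * σ) by ring, unitLocalHc_mul_unit α hu2 (d₂ : ℤ)]
      linarith
    have b3 : classLocalHc α 1 0 k a ≤ B := by
      rw [classLocalHc_one_eq, ← one_mul (a : ℤ), unitLocalHc_mul_unit α hu1 1]
      exact hM3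
    exact mul_le_mul (mul_le_mul b1 b2 (classLocalHc_nonneg _ _ _ _ _)
      (mul_nonneg zero_le_two (mul_nonneg hD₁0 hB0))) b3 (classLocalHc_nonneg _ _ _ _ _)
      (mul_nonneg (mul_nonneg zero_le_two (mul_nonneg hD₁0 hB0)) (mul_nonneg zero_le_two (mul_nonneg hD₂0 hB0)))
  refine (Finset.sum_le_sum hpt).trans ?_
  rw [Finset.sum_const, nsmul_eq_mul]
  have hcard : (((Finset.range k).filter (Nat.Coprime k)).card : ℝ) ≤ k := by
    exact_mod_cast (Finset.card_filter_le _ _).trans (Finset.card_range k).le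
  have hDD : 0 ≤ D₁ * D₂ * (B * B * B) := by positivity
  calc (((Finset.range k).filter (Nat.Coprime k)).card : ℝ) * ((2 * (D₁ * B)) * (2 * (D₂ * B)) * B)
      = (((Finset.range k).filter (Nat.Coprime k)).card : ℝ) * (4 * (D₁ * D₂ * (B * B * B))) := by ring
    _ ≤ (k : ℝ) * (4 * (D₁ * D₂ * (B * B * B))) := mul_le_mul_of_nonneg_right hcard (by positivity)
    _ = 4 * D₁ * D₂ * ((k : ℝ) * (B * B * B)) := by ring
    _ = _ := by rw [hB, mul_cube_rpow_prod_eq hk]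

/-! ### The sum over the levels -/

/-- **Uniform bound for `𝓗₃(R)`, explicit form.** For `2/3 < α ≤ 1`, `σ = ±1`, `d₁, d₂ ≥ 1` and every `R`:
`Σ_{1 ≤ k ≤ R} Σ_{a < k, (k,a)=1} Hc(2,1,k;d₁a) Hc(2,1,k;σd₂a) Hc(1,0,k;a) ≤ 4 exp(250/(3α−2)) · d₁τ(d₁) · d₂τ(d₂)`
(level-`k` bound, finite Euler product `Σ_{k ≤ R} k^{−(3α−1)} ∏_{p∣k} 125 ≤ exp(Σ_p 250 p^{−(3α−1)})`, and
`Σ_p p^{−(3α−1)} ≤ 1/(3α−2)`). [cite: Harper2016, §5] -/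
theorem parityHcSum3_le_explicit {α : ℝ} (hα : 2 / 3 < α) (hα1 : α ≤ 1) {σ : ℤ} (hσ : σ = 1 ∨ σ = -1)
    {d₁ d₂ : ℕ} (hd₁ : d₁ ≠ 0) (hd₂ : d₂ ≠ 0) (R : ℕ) :
    ∑ k ∈ Icc 1 R, ∑ a ∈ (Finset.range k).filter (Nat.Coprime k),
        classLocalHc α 2 1 k (d₁ * a) * classLocalHc α 2 1 k (σ * (d₂ * a)) * classLocalHc α 1 0 k a ≤
      4 * Real.exp (250 / (3 * α - 2)) * ((d₁ : ℝ) * (d₁.divisors.card : ℝ)) *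
        ((d₂ : ℝ) * (d₂.divisors.card : ℝ)) := by
  have hs : 1 ≤ 3 * α - 1 := by linarith
  have hpt : ∀ k ∈ Icc 1 R, ∑ a ∈ (Finset.range k).filter (Nat.Coprime k),
      classLocalHc α 2 1 k (d₁ * a) * classLocalHc α 2 1 k (σ * (d₂ * a)) * classLocalHc α 1 0 k a ≤
        4 * ((d₁ : ℝ) * (d₁.divisors.card : ℝ)) * ((d₂ : ℝ) * (d₂.divisors.card : ℝ)) *
          ((k : ℝ) ^ (-(3 * α - 1)) * ∏ _p ∈ k.primeFactors, (125 : ℝ)) :=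
    fun k hk => sum_coprime_classLocalHc_triple_le hα1 hσ hd₁ hd₂ (by have := (Finset.mem_Icc.mp hk).1; omega)
  refine (Finset.sum_le_sum hpt).trans ?_
  rw [← Finset.mul_sum]
  have hE : ∑ q ∈ Finset.Icc 1 R, (q : ℝ) ^ (-(3 * α - 1)) * ∏ _p ∈ q.primeFactors, (125 : ℝ) ≤
      Real.exp (∑ p ∈ (R + 1).primesBelow, 2 * (125 : ℝ) * (p : ℝ) ^ (-(3 * α - 1))) :=
    Endgame.sum_rpow_neg_mul_prod_primeFactors_le hs (fun _ => by norm_num) R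
  have hexp : Real.exp (∑ p ∈ (R + 1).primesBelow, 2 * (125 : ℝ) * (p : ℝ) ^ (-(3 * α - 1))) ≤
      Real.exp (250 / (3 * α - 2)) := by
    apply Real.exp_le_exp.mpr
    rw [← Finset.mul_sum]
    have h := Endgame.sum_primesBelow_rpow_neg_le (s := 3 * α - 1) (by linarith) R
    rw [show 3 * α - 1 - 1 = 3 * α - 2 by ring] at h
    calc 2 * (125 : ℝ) * ∑ p ∈ (R + 1).primesBelow, (p : ℝ) ^ (-(3 * α - 1)) ≤ 2 * 125 * (1 / (3 * α - 2)) :=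
          mul_le_mul_of_nonneg_left h (by norm_num)
      _ = 250 / (3 * α - 2) := by ring
  have hD : 0 ≤ 4 * ((d₁ : ℝ) * (d₁.divisors.card : ℝ)) * ((d₂ : ℝ) * (d₂.divisors.card : ℝ)) := by positivity
  calc 4 * ((d₁ : ℝ) * (d₁.divisors.card : ℝ)) * ((d₂ : ℝ) * (d₂.divisors.card : ℝ)) *
        ∑ k ∈ Icc 1 R, (k : ℝ) ^ (-(3 * α - 1)) * ∏ _p ∈ k.primeFactors, (125 : ℝ)
      ≤ 4 * ((d₁ : ℝ) * (d₁.divisors.card : ℝ)) * ((d₂ : ℝ) * (d₂.divisors.card : ℝ)) *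
          Real.exp (250 / (3 * α - 2)) := mul_le_mul_of_nonneg_left (hE.trans hexp) hD
    _ = _ := by ring

/-- **Uniform bound for the majorant sum `𝓗₃(R)` of `parity_major_arcs`.** There is an absolute `C > 0` such that for
`1 − 10⁻⁴ ≤ α ≤ 1`, `σ = ±1`, `d₁, d₂ ≥ 1` and EVERY `R`:
`Σ_{1 ≤ k ≤ R} Σ_{a < k, (k,a)=1} Hc(2,1,k;d₁a) Hc(2,1,k;σd₂a) Hc(1,0,k;a) ≤ C · d₁τ(d₁) · d₂τ(d₂)`
(`C = 4e^{251}` from `parityHcSum3_le_explicit`). [cite: Harper2016, §5] -/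
theorem parityHcSum3_le : ∃ C : ℝ, 0 < C ∧ ∀ (α : ℝ), 1 - 1 / 10000 ≤ α → α ≤ 1 → ∀ (σ : ℤ), (σ = 1 ∨ σ = -1) →
    ∀ (d₁ d₂ : ℕ), d₁ ≠ 0 → d₂ ≠ 0 → ∀ R : ℕ,
      ∑ k ∈ Icc 1 R, ∑ a ∈ (Finset.range k).filter (Nat.Coprime k),
          classLocalHc α 2 1 k (d₁ * a) * classLocalHc α 2 1 k (σ * (d₂ * a)) * classLocalHc α 1 0 k a ≤
        C * ((d₁ : ℝ) * ((Nat.divisors d₁).card : ℝ)) * ((d₂ : ℝ) * ((Nat.divisors d₂).card : ℝ)) := by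
  refine ⟨4 * Real.exp 251, by positivity, fun α hα hα1 σ hσ d₁ d₂ hd₁ hd₂ R => ?_⟩
  refine (parityHcSum3_le_explicit (by linarith) hα1 hσ hd₁ hd₂ R).trans ?_
  have hexp : Real.exp (250 / (3 * α - 2)) ≤ Real.exp 251 := by
    apply Real.exp_le_exp.mpr
    rw [div_le_iff₀ (by linarith)]
    linarith
  have hD : 0 ≤ ((d₁ : ℝ) * (d₁.divisors.card : ℝ)) * ((d₂ : ℝ) * (d₂.divisors.card : ℝ)) := by positivity
  calc 4 * Real.exp (250 / (3 * α - 2)) * ((d₁ : ℝ) * (d₁.divisors.card : ℝ)) * ((d₂ : ℝ) * (d₂.divisors.card : ℝ))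
      = (4 * Real.exp (250 / (3 * α - 2))) * (((d₁ : ℝ) * (d₁.divisors.card : ℝ)) *
          ((d₂ : ℝ) * (d₂.divisors.card : ℝ))) := by ring
    _ ≤ (4 * Real.exp 251) * (((d₁ : ℝ) * (d₁.divisors.card : ℝ)) * ((d₂ : ℝ) * (d₂.divisors.card : ℝ))) :=
        mul_le_mul_of_nonneg_right (by linarith) hD
    _ = _ := by ring

end SmoothArcs

end Literature.NumberTheory.Sieve

end
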